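import Mathlib
import HarnessLib
import Summits.HubbardSuperconductivity.HubbardSuperconductivity.Theorems.KLProgrammeKLRegimeEngineTowerScaling

/-!
# Route `KLProgramme` — crux K3 ENGINE (stmt-HubbardSuperconductivity-20437 `KLRegimeEngineV17F2`), stub (b) v2, THE LEVELS PACKAGE (ℓ):
# (I1-dim), third brick — UNITS: the kit's step right side in absolute sizes `B(m) = K·u^m·b(m)` equals, after division by the output unit `u^p·K`,
# the same right side in the dimensionless sizes `b` with RESCALED constants (E1-LEVELS-BLUEPRINT-g8 §9, memo E1-TOWER-BLOCKED §4 «x_k scale-free»; E1 lead r2d-p2 g8)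

With the law's unit `2^{(3m−5)J} = (8^J)^m·(2^{5J})⁻¹` (…TowerScaling `two_zpow_law_eq`: `u := 8^J`, `K := 2^{−5J}`) the absolute sizes of a block are
`B(m) = K·u^m·b(m)`.  Dividing the kit-shaped right side (…TowerDoorToKit) by the output unit `u^p·K` gives the kit's `hstep` right side in `b` with
**`τ̂ := τ·u`, `σ̂ := σ·u`, `Φ̂ := Φ·K`, `ψ̂ := ψ/u`** — the `k`-FREE numbers of memo §4 when `κ² ∝ 8^{−J}`, `α ∝ 4^J`, `ρ ∝ 8^{−J/2}`:

* `towerS_const_mul`, `towerV_const_mul`, `towerFO_const_mul` (linearity in a constant factor; the `u^m` part is …TowerScaling's `tower*_pow_mul`);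
* **`kitGraded_units`** — `(Σ_{n∈Icc 2 N} e·Φ^{n−1}·ψ^p·towerS D τ B n p)/(u^p·K) = Σ_{n∈Icc 2 N} e·Φ̂^{n−1}·ψ̂^p·towerS D τ̂ b n p`;
* **`kitTail_units`** — `(ψ^p·e·V·(ΦV)^N/(1−ΦV))/(u^p·K) = ψ̂^p·e·V̂·(Φ̂V̂)^N/(1−Φ̂V̂)`, `V = towerV D τ B = K·V̂`, `V̂ = towerV D τ̂ b`;
* **`kitFO_units`** — `towerFO D σ B p/(u^p·K) = towerFO D σ̂ b p`.
Pure real analysis; nothing about the model is asserted.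
-/

noncomputable section

namespace Summit.HubbardSuperconductivity.HubbardSuperconductivity.Theorems.EngineV8

set_option linter.dupNamespace false -- summit = problem name (single-conjunct summit), D-0017

open Real Finset

/-- Linearity of `towerS` in a constant factor of the sizes: `towerS D τ (K·μ) n p = K^n · towerS D τ μ n p`. -/
theorem towerS_const_mul (D : ℕ) (τ K : ℝ) (μ : ℕ → ℝ) (n p : ℕ) :
    towerS D τ (fun m => K * μ m) n p = K ^ n * towerS D τ μ n p := by
  unfold towerS
  rw [mul_sum]
  refine sum_congr rfl fun δ _ => ?_
  rw [show (K ^ n : ℝ) = ∏ _a : Fin n, K by rw [prod_const, card_univ, Fintype.card_fin], ← prod_mul_distrib]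
  exact prod_congr rfl fun a _ => by ring

/-- Linearity of `towerV`: `towerV D τ (K·μ) = K · towerV D τ μ`. -/
theorem towerV_const_mul (D : ℕ) (τ K : ℝ) (μ : ℕ → ℝ) : towerV D τ (fun m => K * μ m) = K * towerV D τ μ := by
  unfold towerV
  rw [mul_sum]
  exact sum_congr rfl fun m _ => by ring

/-- Linearity of `towerFO`: `towerFO D σ (K·μ) p = K · towerFO D σ μ p`. -/
theorem towerFO_const_mul (D : ℕ) (σ K : ℝ) (μ : ℕ → ℝ) (p : ℕ) : towerFO D σ (fun m => K * μ m) p = K * towerFO D σ μ p := by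
  unfold towerFO
  rw [mul_sum]
  exact sum_congr rfl fun m _ => by ring

/-- `towerS` in absolute sizes `B = K·u^m·b`: `towerS D τ B n p = K^n · towerS D (τu) b n p`. -/
theorem towerS_units (D : ℕ) (τ K u : ℝ) (b : ℕ → ℝ) (n p : ℕ) :
    towerS D τ (fun m => K * (u ^ m * b m)) n p = K ^ n * towerS D (τ * u) b n p := by
  rw [towerS_const_mul, towerS_pow_mul]

/-- `towerV` in absolute sizes: `towerV D τ B = K · towerV D (τu) b`. -/
theorem towerV_units (D : ℕ) (τ K u : ℝ) (b : ℕ → ℝ) : towerV D τ (fun m => K * (u ^ m * b m)) = K * towerV D (τ * u) b := by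
  rw [towerV_const_mul, towerV_pow_mul]

/-- `towerFO` in absolute sizes: `towerFO D σ B p = K · u^p · towerFO D (σu) b p`. -/
theorem towerFO_units (D : ℕ) (σ K u : ℝ) (b : ℕ → ℝ) (p : ℕ) :
    towerFO D σ (fun m => K * (u ^ m * b m)) p = K * u ^ p * towerFO D (σ * u) b p := by
  rw [towerFO_const_mul, towerFO_pow_mul, mul_assoc]

/-- **UNITS IN THE GRADED PART**: dividing by the output unit `u^p·K` rescales `Φ ↦ Φ·K`, `ψ ↦ ψ/u`, `τ ↦ τ·u` (orders `n ≥ 1`). -/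
theorem kitGraded_units {K u : ℝ} (hK : K ≠ 0) (hu : u ≠ 0) (D : ℕ) (τ Φ ψ : ℝ) (b : ℕ → ℝ) (N p : ℕ) :
    (∑ n ∈ Icc 2 N, exp 1 * Φ ^ (n - 1) * ψ ^ p * towerS D τ (fun m => K * (u ^ m * b m)) n p) / (u ^ p * K) =
      ∑ n ∈ Icc 2 N, exp 1 * (Φ * K) ^ (n - 1) * (ψ / u) ^ p * towerS D (τ * u) b n p := by
  rw [sum_div]
  refine sum_congr rfl fun n hn => ?_
  have hn1 : 1 ≤ n := by have := (mem_Icc.1 hn).1; omega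
  rw [towerS_units]
  obtain ⟨k, rfl⟩ : ∃ k, n = k + 1 := ⟨n - 1, by omega⟩
  rw [Nat.add_sub_cancel, pow_succ, mul_pow, div_pow]
  have hup : u ^ p ≠ 0 := pow_ne_zero _ hu
  field_simp

/-- **UNITS IN THE TAIL**: with `V = towerV D τ B = K·V̂`, `(ψ^p·e·V·(ΦV)^N/(1−ΦV))/(u^p·K) = (ψ/u)^p·e·V̂·((ΦK)V̂)^N/(1−(ΦK)V̂)`. -/
theorem kitTail_units {K u : ℝ} (hK : K ≠ 0) (hu : u ≠ 0) (D : ℕ) (τ Φ ψ : ℝ) (b : ℕ → ℝ) (N p : ℕ) :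
    ψ ^ p * exp 1 * towerV D τ (fun m => K * (u ^ m * b m)) * (Φ * towerV D τ (fun m => K * (u ^ m * b m))) ^ N /
        (1 - Φ * towerV D τ (fun m => K * (u ^ m * b m))) / (u ^ p * K) =
      (ψ / u) ^ p * exp 1 * towerV D (τ * u) b * (Φ * K * towerV D (τ * u) b) ^ N / (1 - Φ * K * towerV D (τ * u) b) := by
  rw [towerV_units]
  have hup : u ^ p ≠ 0 := pow_ne_zero _ hu
  rw [div_pow, show Φ * (K * towerV D (τ * u) b) = Φ * K * towerV D (τ * u) b by ring]
  field_simp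

/-- **UNITS IN THE FIRST ORDER**: `towerFO D σ B p/(u^p·K) = towerFO D (σu) b p`. -/
theorem kitFO_units {K u : ℝ} (hK : K ≠ 0) (hu : u ≠ 0) (D : ℕ) (σ : ℝ) (b : ℕ → ℝ) (p : ℕ) :
    towerFO D σ (fun m => K * (u ^ m * b m)) p / (u ^ p * K) = towerFO D (σ * u) b p := by
  rw [towerFO_units]
  have hup : u ^ p ≠ 0 := pow_ne_zero _ hu
  field_simp

/-- **THE WHOLE STEP RIGHT SIDE IN UNITS**: first order + graded + tail, divided by `u^p·K`, is the kit's `hstep` right side in the dimensionless sizes `b` with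
`(σ̂, τ̂, Φ̂, ψ̂) = (σu, τu, ΦK, ψ/u)`. -/
theorem kitStep_units {K u : ℝ} (hK : K ≠ 0) (hu : u ≠ 0) (D : ℕ) (σ τ Φ ψ : ℝ) (b : ℕ → ℝ) (N p : ℕ) :
    (towerFO D σ (fun m => K * (u ^ m * b m)) p +
        ∑ n ∈ Icc 2 N, exp 1 * Φ ^ (n - 1) * ψ ^ p * towerS D τ (fun m => K * (u ^ m * b m)) n p +
        ψ ^ p * exp 1 * towerV D τ (fun m => K * (u ^ m * b m)) * (Φ * towerV D τ (fun m => K * (u ^ m * b m))) ^ N /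
          (1 - Φ * towerV D τ (fun m => K * (u ^ m * b m)))) / (u ^ p * K) =
      towerFO D (σ * u) b p + ∑ n ∈ Icc 2 N, exp 1 * (Φ * K) ^ (n - 1) * (ψ / u) ^ p * towerS D (τ * u) b n p +
        (ψ / u) ^ p * exp 1 * towerV D (τ * u) b * (Φ * K * towerV D (τ * u) b) ^ N / (1 - Φ * K * towerV D (τ * u) b) := by
  rw [add_div, add_div, kitFO_units hK hu, kitGraded_units hK hu, kitTail_units hK hu]

end Summit.HubbardSuperconductivity.HubbardSuperconductivity.Theorems.EngineV8

end
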